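import Summits.NavierStokesRegularity.NavierStokesRegularity.Theorems.SoloRefuteTarver2016ClayWave
import Literature.Analysis.FluidPDE.SereginZajaczkowski2007SwirlRotation
import Literature.Analysis.FluidPDE.AxisymNoSwirlScalarEq
import Literature.Analysis.FluidPDE.DistributionalPressurePoisson
import Literature.Analysis.FunctionSpaces.GaussianSchwartz
import HarnessLib

/-!
# Tarver (2016), C80 — model file 2/3: the Gaussian swirl datum and the vector wave `U = −½ J ∇W`

Companion to `Literature.Claims.NS.Tarver2016` (row C80 of cell `ns-claims`); imports the scalar
Gaussian spherical wave `Wsc` (`…SoloRefuteTarver2016ClayWave`); consumed by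
`…Theorems.SoloRefuteTarver2016Clay`. Kit by ns-claims-typist-1 g3.

Contents (all folklore calculus):
* the Gaussian profile `e^{−|x|²}` (`gauss`) with `∇`, `Δ` (tree `RadialCalculus`);
* **the datum** `u₀(x) = e^{−|x|²} J x`, `J x = (−x₁, x₀, 0)` the tree's `rotGen` (`swirl0`): smooth,
  divergence-free (`divergence_smul_rotGen`), of Clay's class (4) — it is the Schwartz map
  `bilinLeftCLM lsmul J (realGaussianSchwartz ℝ³ 1)` (`hasRapidSpatialDecay_swirl0`); its convective
  term `(u₀·∇)u₀ = e^{−2|x|²} J(Jx)` and Laplacian `Δu₀ = (4|x|² − 10) e^{−|x|²} Jx`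
  (`laplacian_smul_rotGen`);
* **the vector wave** `U(t, x) = −½ J ∇ₓW(t, x)` (`Uvec`; `= ½ curl (W e₂)`): smooth on the half-space,
  `U(0) = u₀` (`Uvec_zero`), `∂ₜU(0) = 0` (evenness in `t`), and `∂ₜ²U = ΔU` (`wave_Uvec`: the scalar
  equation `wave_Wsc`, the exchanges `∂ₜ∇ = ∇∂ₜ` (`hasDerivAt_gradient_slice`) and `Δ∇ = ∇Δ` (tree
  `laplacian_gradient`), and `Δ ∘ L = L ∘ Δ` for the fixed linear `L = −½J`); so `U` is a smooth global
  solution of Tarver's «Simple Wave equation» with `ν = 1` (`Uvec_isWaveSolution`).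

WHAT THIS IS NOT: not a statement about the Navier–Stokes problem itself; not about any author beyond
the typed locator.
-/

noncomputable section

open Set Filter Topology InnerProductSpace Function
open Literature.Analysis.FluidPDE Literature.Analysis.FunctionSpaces Literature.Claims.NS.Tarver2016
open scoped RealInnerProductSpace Laplacian ContDiff SchwartzMap

-- The summit's canonical theorem namespace repeats the summit name (single-conjunct summit).
set_option linter.dupNamespace false

namespace Summit.NavierStokesRegularity.NavierStokesRegularity.Theorems.Tarver2016

/-- Local notation for physical space. -/
local notation "ℝ³" => EuclideanSpace ℝ (Fin 3)

/-! ## The Gaussian profile `σ ↦ e^{−σ}` in the variable `σ = |x|²` -/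

/-- The radial profile `g(σ) = e^{−σ}`. [folklore] -/
def gProf (σ : ℝ) : ℝ := Real.exp (-σ)

/-- `g' = −g`. [folklore] -/
theorem hasDerivAt_gProf (σ : ℝ) : HasDerivAt gProf (-Real.exp (-σ)) σ := by
  show HasDerivAt (fun s => Real.exp (-s)) (-Real.exp (-σ)) σ
  have h := (hasDerivAt_neg σ).exp
  simpa using h

/-- `(−g)' = g`. [folklore] -/
theorem hasDerivAt_neg_gProf (σ : ℝ) : HasDerivAt (fun s => -Real.exp (-s)) (Real.exp (-σ)) σ := by
  have h : HasDerivAt (fun s => -Real.exp (-s)) (-(-Real.exp (-σ))) σ := (hasDerivAt_gProf σ).neg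
  simpa using h

/-- The Gaussian `x ↦ e^{−|x|²}` on `ℝ³`, written through the profile. [folklore] -/
def gauss (x : ℝ³) : ℝ := gProf (‖x‖ ^ 2)

/-- Unfolding `gauss x = e^{−|x|²}`. [folklore] -/
theorem gauss_apply (x : ℝ³) : gauss x = Real.exp (-‖x‖ ^ 2) := rfl

/-- The Gaussian is smooth. [folklore] -/
theorem contDiff_gauss {n : WithTop ℕ∞} : ContDiff ℝ n gauss :=
  (Real.contDiff_exp.comp contDiff_neg).comp (contDiff_norm_sq ℝ)

/-- `∂_h e^{−|x|²} = −2 e^{−|x|²} ⟪x, h⟫`. [folklore] -/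
theorem fderiv_gauss_apply (x h : ℝ³) :
    fderiv ℝ gauss x h = 2 * (-Real.exp (-‖x‖ ^ 2)) * ⟪x, h⟫ :=
  fderiv_comp_norm_sq_apply (hasDerivAt_gProf (‖x‖ ^ 2)) h

/-- `∇ e^{−|x|²} = −2 e^{−|x|²} x`. [folklore] -/
theorem gradient_gauss (x : ℝ³) : gradient gauss x = (2 * (-Real.exp (-‖x‖ ^ 2))) • x := by
  refine ext_inner_right ℝ fun y => ?_
  rw [inner_gradient_left, fderiv_gauss_apply, real_inner_smul_left]

/-- `Δ e^{−|x|²} = (4|x|² − 6) e^{−|x|²}` on `ℝ³`. [folklore] -/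
theorem laplacian_gauss (x : ℝ³) :
    (Δ gauss) x = (4 * ‖x‖ ^ 2 - 6) * Real.exp (-‖x‖ ^ 2) := by
  have h := laplacian_comp_norm_sq (E := ℝ³) (g := gProf) (g₁ := fun s => -Real.exp (-s))
    (U := univ) isOpen_univ (fun σ _ => hasDerivAt_gProf σ) (z := x) (mem_univ _)
    (hasDerivAt_neg_gProf (‖x‖ ^ 2))
  rw [finrank_euclideanSpace_fin] at h
  have e : gauss = fun w : ℝ³ => gProf (‖w‖ ^ 2) := rfl
  rw [e, h]
  push_cast
  ring

/-- `W(0, ·) = e^{−|x|²}`. [folklore] -/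
theorem Wsc_zero : Wsc 0 = gauss := by
  funext x
  simp [Wsc, gauss, gProf, entire_apply_zero, coef]

/-! ## The datum: the Gaussian swirl `u₀ = e^{−|x|²} J x` -/

/-- **The datum** `u₀(x) = e^{−|x|²} (−x₁, x₀, 0) = e^{−|x|²} J x`. [folklore] -/
def swirl0 (x : ℝ³) : ℝ³ := gauss x • rotGen x

/-- The datum is smooth. [folklore] -/
theorem contDiff_swirl0 {n : WithTop ℕ∞} : ContDiff ℝ n swirl0 :=
  contDiff_gauss.smul contDiff_rotGen

/-- The datum as a Schwartz map: `e^{−|x|²}` (tree `realGaussianSchwartz`) times the linear `J`. -/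
theorem swirl0_eq_schwartz :
    swirl0 = ⇑(SchwartzMap.bilinLeftCLM (ContinuousLinearMap.lsmul ℝ ℝ : ℝ →L[ℝ] ℝ³ →L[ℝ] ℝ³)
      (rotGenL.hasTemperateGrowth) (realGaussianSchwartz ℝ³ 1)) := by
  funext x
  rw [SchwartzMap.bilinLeftCLM_apply]
  simp only [ContinuousLinearMap.lsmul_apply, rotGenL_apply, realGaussianSchwartz_apply one_pos]
  simp [swirl0, gauss, gProf]

/-- The datum is of Clay's class (4) (Schwartz decay of all derivatives). [folklore] -/
theorem hasRapidSpatialDecay_swirl0 : HasRapidSpatialDecay swirl0 := by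
  rw [swirl0_eq_schwartz]
  intro n K
  exact ⟨_, fun x => SchwartzMap.one_add_le_sup_seminorm_apply (𝕜 := ℝ) (m := (K, n)) le_rfl le_rfl _ x⟩

/-- The datum is divergence free: `div (g J) = ⟪J x, ∇g⟫ = −2g ⟪Jx, x⟫ = 0`. [folklore] -/
theorem isDivFree_swirl0 : NSWave0.IsDivFree swirl0 := by
  intro x
  have hd : DifferentiableAt ℝ gauss x := (contDiff_gauss (n := 1)).differentiable one_ne_zero x
  show VectorCalculus.divergence (fun y => gauss y • rotGen y) x = 0
  rw [SereginZajaczkowski2007.divergence_smul_rotGen hd, gradient_gauss, inner_smul_right,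
    inner_rotGen_self, mul_zero]

/-! ## Pointwise calculus of the datum -/

/-- `(u₀·∇)u₀ = g² J(Jx)`: the derivative of the radial factor along `u₀ ⊥ x` vanishes. [folklore] -/
theorem convect_swirl0 (x : ℝ³) :
    fderiv ℝ swirl0 x (swirl0 x) = (gauss x * gauss x) • rotGen (rotGen x) := by
  have hd : DifferentiableAt ℝ gauss x := (contDiff_gauss (n := 1)).differentiable one_ne_zero x
  show fderiv ℝ (fun y => gauss y • rotGen y) x (swirl0 x) = _
  rw [fderiv_smul_rotGen_apply hd, swirl0, fderiv_gauss_apply, inner_smul_right,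
    real_inner_comm (rotGen x) x, inner_rotGen_self, mul_zero, mul_zero, zero_smul, zero_add,
    rotGen_smul, smul_smul]

/-- `Δu₀ = (4|x|² − 10) e^{−|x|²} J x` (`Δ(gJ) = (Δg) Jx + 2 J∇g`). [folklore] -/
theorem laplacian_swirl0 (x : ℝ³) :
    (Δ swirl0) x = ((4 * ‖x‖ ^ 2 - 10) * Real.exp (-‖x‖ ^ 2)) • rotGen x := by
  have h := laplacian_smul_rotGen (f := gauss) (contDiff_gauss (n := 2)) x
  have e : (fun y => gauss y • rotGen y) = swirl0 := rfl
  rw [e] at h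
  rw [h, laplacian_gauss, gradient_gauss, rotGen_smul, smul_smul, ← add_smul]
  congr 1
  ring

/-! ### The vector wave `U = −½ J ∇W` -/

/-- The fixed linear map `v ↦ −½ J v`. [folklore] -/
def Lrot : ℝ³ →L[ℝ] ℝ³ := (-(1 / 2 : ℝ)) • rotGenL

/-- Unfolding `L v = −½ J v`. [folklore] -/
theorem Lrot_apply (v : ℝ³) : Lrot v = (-(1 / 2 : ℝ)) • rotGen v := rfl

/-- **The vector wave** `U(t, x) = −½ J ∇ₓW(t, x)` (`= ½ curl (W e₂)`): a smooth, divergence-free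
solution of `∂ₜ²U = ΔU` on `ℝ × ℝ³` with `U(0) = e^{−|x|²} J x` and `∂ₜU(0) = 0`. [folklore] -/
def Uvec (t : ℝ) (x : ℝ³) : ℝ³ := Lrot (gradient (Wsc t) x)

/-- `(t, x) ↦ ∇ₓW(t, x)` is jointly smooth. [folklore] -/
theorem isSmoothSpaceTimeOn_gradW : IsSmoothSpaceTimeOn univ (fun t x => gradient (Wsc t) x) :=
  isSmoothSpaceTimeOn_Wsc.gradient uniqueDiffOn_univ

/-- `U` is jointly smooth on `ℝ × ℝ³`. [folklore] -/
theorem isSmoothSpaceTimeOn_Uvec : IsSmoothSpaceTimeOn univ Uvec :=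
  Lrot.contDiff.comp_contDiffOn isSmoothSpaceTimeOn_gradW

/-- `U` is smooth on the closed half-space (Fefferman's (6)). [folklore] -/
theorem Uvec_smooth : IsSmoothOnHalfSpace Uvec :=
  isSmoothSpaceTimeOn_Uvec.mono (subset_univ _)

/-- `U(0, ·) = e^{−|x|²} J x` is the Gaussian swirl. [folklore] -/
theorem Uvec_zero : Uvec 0 = swirl0 := by
  funext x
  rw [Uvec, Wsc_zero, gradient_gauss, Lrot_apply, rotGen_smul, smul_smul, swirl0, gauss_apply]
  congr 1
  ring

/-- `U` is even in time. [folklore] -/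
theorem Uvec_neg (t : ℝ) (x : ℝ³) : Uvec (-t) x = Uvec t x := by
  have h : Wsc (-t) = Wsc t := funext (Wsc_neg t)
  rw [Uvec, Uvec, h]

/-- Time lines of `U` are differentiable. [folklore] -/
theorem hasDerivAt_Uvec_timeLine (t : ℝ) (x : ℝ³) :
    HasDerivAt (fun s => Uvec s x) (deriv (fun s => Uvec s x) t) t :=
  isSmoothSpaceTimeOn_Uvec.hasDerivAt_timeLine isOpen_univ (mem_univ t) x

/-- `∂ₜU(0, x) = 0` (`U` is even in `t`). [folklore] -/
theorem deriv_Uvec_zero (x : ℝ³) : deriv (fun s => Uvec s x) 0 = 0 := by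
  have h : (fun s => Uvec s x) = fun s => Uvec (-s) x := funext fun s => (Uvec_neg s x).symm
  have h1 : deriv (fun s => Uvec s x) 0 = -deriv (fun s => Uvec s x) (-0) := by
    conv_lhs => rw [h]
    exact deriv_comp_neg (fun s => Uvec s x) 0
  rw [neg_zero] at h1
  have h2 : (2 : ℝ) • deriv (fun s => Uvec s x) 0 = 0 := by
    rw [two_smul]
    nth_rewrite 2 [h1]
    exact add_neg_cancel _
  exact (smul_eq_zero.mp h2).resolve_left two_ne_zero

/-- The one-sided time derivative at `t = 0` vanishes. [folklore] -/
theorem derivWithin_Uvec_zero (x : ℝ³) : derivWithin (fun s => Uvec s x) (Ici 0) 0 = 0 := by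
  rw [(hasDerivAt_Uvec_timeLine 0 x).hasDerivWithinAt.derivWithin (uniqueDiffOn_Ici 0 0 self_mem_Ici),
    deriv_Uvec_zero]

/-- **The vector wave equation** `∂ₜ²U = ΔU` on `ℝ × ℝ³` (the scalar equation for `W`, the exchanges
`∂ₜ∇ = ∇∂ₜ` and `Δ∇ = ∇Δ`, and linearity of `−½J`). [folklore] -/
theorem wave_Uvec (t : ℝ) (x : ℝ³) : iteratedDeriv 2 (fun s => Uvec s x) t = (Δ (Uvec t)) x := by
  -- the first two time derivatives of `W` as smooth fields
  have hW1s : IsSmoothSpaceTimeOn univ (fun s y => deriv (fun r => Wsc r y) s) :=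
    isSmoothSpaceTimeOn_Wsc.isSmoothSpaceTimeOn_deriv isOpen_univ
  have hg1 : ∀ s, HasDerivAt (fun r => gradient (Wsc r) x)
      (gradient (fun y => deriv (fun r => Wsc r y) s) x) s := fun s =>
    hasDerivAt_gradient_slice isSmoothSpaceTimeOn_Wsc s x
  have hg2 : HasDerivAt (fun r => gradient (fun y => deriv (fun r' => Wsc r' y) r) x)
      (gradient (fun y => deriv (fun r => (fun s y => deriv (fun r' => Wsc r' y) s) r y) t) x) t :=
    hasDerivAt_gradient_slice hW1s t x
  have hU1 : ∀ s, HasDerivAt (fun r => Uvec r x)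
      (Lrot (gradient (fun y => deriv (fun r => Wsc r y) s) x)) s := fun s =>
    (Lrot.hasFDerivAt).comp_hasDerivAt s (hg1 s)
  have hdU1 : deriv (fun r => Uvec r x) =
      fun s => Lrot (gradient (fun y => deriv (fun r => Wsc r y) s) x) := funext fun s => (hU1 s).deriv
  have hU2 : HasDerivAt (fun s => Lrot (gradient (fun y => deriv (fun r => Wsc r y) s) x))
      (Lrot (gradient (fun y => deriv (fun r => (fun s y => deriv (fun r' => Wsc r' y) s) r y) t) x)) t :=
    (Lrot.hasFDerivAt).comp_hasDerivAt t hg2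
  rw [iteratedDeriv_succ, iteratedDeriv_one, hdU1, hU2.deriv]
  -- the scalar wave equation, as an identity of functions of `y`
  have hW2eq : (fun y => deriv (fun r => (fun s y => deriv (fun r' => Wsc r' y) s) r y) t) =
      fun y => (Δ (Wsc t)) y := by
    funext y
    have := wave_Wsc t y
    rw [iteratedDeriv_succ, iteratedDeriv_one] at this
    exact this
  rw [hW2eq]
  -- `Δ U = −½ J Δ∇W = −½ J ∇ΔW`
  have hC3 : ContDiff ℝ 3 (Wsc t) :=
    contDiff_infty.1 (isSmoothSpaceTimeOn_Wsc.contDiff_slice (mem_univ t)) 3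
  have hgradC2 : ContDiffAt ℝ 2 (gradient (Wsc t)) x :=
    (contDiff_infty.1 (isSmoothSpaceTimeOn_gradW.contDiff_slice (mem_univ t)) 2).contDiffAt
  have hΔU : (Δ (Uvec t)) x = Lrot ((Δ (gradient (Wsc t))) x) := by
    have e : Uvec t = (Lrot : ℝ³ → ℝ³) ∘ gradient (Wsc t) := rfl
    rw [e, hgradC2.laplacian_CLM_comp_left]
    rfl
  rw [hΔU, laplacian_gradient hC3]

/-- `U` solves «The Simple Wave equation» `∂ₜ²U = νΔU` with `ν = 1`. [folklore] -/
theorem Uvec_isWaveSolution : Literature.Claims.NS.Tarver2016.IsWaveSolution 1 Uvec := by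
  intro t _ x
  rw [one_smul]
  exact wave_Uvec t x

end Summit.NavierStokesRegularity.NavierStokesRegularity.Theorems.Tarver2016

end

-- WHAT THIS IS NOT: not a statement about the Navier–Stokes problem itself; not about any author beyond
-- the typed locator.
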